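import Mathlib
import Literature.RingTheory.KrullDimension.AffineDimension
import Literature.AlgebraicGeometry.Resolution.RegularLocalRingsProofs
import HarnessLib

/-!
# Adjoining a `d`-th root of a regular parameter keeps a local ring regular

Topic: `Literature/AlgebraicGeometry/Resolution`. The auxiliary ring behind the completion-free
treatment of Hironaka's weighted orders in the termination proof of Cossart–Piltant 2008,
Prop. 4.4 (p. 11): for a regular local ring `(A, 𝔪, k)` of dimension `m + 1` with
`𝔪 = (x₁, …, x_m, y)` and `d ≥ 1`, the ring **`B = A[Z]/(Z^d − y)`** is a regular local ring of
dimension `m + 1` with maximal ideal `(x₁, …, x_m, z)` (`z` the class of `Z`), finite free over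
`A`, and `A → B` is an injective local homomorphism (`AdjoinRoot.isRegularLocalRing_X_pow_sub_C`
and its companions). Weighted monomials `uᵏ y₂ᵃ y₃ᵇ` of weight `k + d(a+b)` become honest
monomials `uᵏ s^{da} t^{db}` of that degree in `A[s, t]/(s^d − y₂, t^d − y₃)`, a regular local
ring with regular system of parameters `(u, s, t)` (`WeightedQuasiRegular.lean`).

## Sources

* H. Hironaka, *Characteristic polyhedra of singularities*, J. Math. Kyoto Univ. 7 (1967). [Hironaka1967]
* H. Matsumura, *Commutative Ring Theory* (1986), Thm. 9.4, Thm. 14.2. [Matsumura1987]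
-/

noncomputable section

open IsLocalRing Polynomial

namespace Literature.AlgebraicGeometry.Resolution

universe u

variable {A : Type u} [CommRing A]

/-- `Z^d − y` is monic for `d ≥ 1`. [folklore] -/
theorem monic_X_pow_sub_C_of_pos (y : A) {d : ℕ} (hd : 0 < d) : (X ^ d - C y : A[X]).Monic :=
  Polynomial.monic_X_pow_sub_C y hd.ne'

section

variable [IsLocalRing A] (y : A) {d : ℕ} (hd : 0 < d)

local notation "g" => (X ^ d - C y : A[X])

/-- The `k`-point `Z ↦ 0` of `A[Z]/(Z^d − y)` when `y ∈ 𝔪`. [folklore] -/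
def AdjoinRoot.residueZero (hy : y ∈ maximalIdeal A) : AdjoinRoot g →+* ResidueField A :=
  AdjoinRoot.lift (residue A) 0 (by
    rw [eval₂_sub, eval₂_X_pow, eval₂_C, zero_pow hd.ne', zero_sub, neg_eq_zero,
      residue_eq_zero_iff]
    exact hy)

variable {y}

/-- `Z ↦ 0` restricts to the residue map on `A`. [folklore] -/
theorem AdjoinRoot.residueZero_of (hy : y ∈ maximalIdeal A) (a : A) :
    AdjoinRoot.residueZero y hd hy (AdjoinRoot.of g a) = residue A a := by
  simp [AdjoinRoot.residueZero]

/-- `Z ↦ 0` kills `z`. [folklore] -/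
theorem AdjoinRoot.residueZero_root (hy : y ∈ maximalIdeal A) :
    AdjoinRoot.residueZero y hd hy (AdjoinRoot.root g) = 0 := by
  simp [AdjoinRoot.residueZero]

/-- `Z ↦ 0` is surjective onto `k`. [folklore] -/
theorem AdjoinRoot.residueZero_surjective (hy : y ∈ maximalIdeal A) :
    Function.Surjective (AdjoinRoot.residueZero y hd hy) := fun t => by
  obtain ⟨a, rfl⟩ := residue_surjective t
  exact ⟨AdjoinRoot.of g a, AdjoinRoot.residueZero_of hd hy a⟩

/-- **The kernel of `Z ↦ 0` is `𝔪B + (z)`.** [folklore] -/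
theorem AdjoinRoot.ker_residueZero (hy : y ∈ maximalIdeal A) :
    RingHom.ker (AdjoinRoot.residueZero y hd hy) =
      (maximalIdeal A).map (AdjoinRoot.of g) ⊔ Ideal.span {AdjoinRoot.root g} := by
  apply le_antisymm
  · intro b hb
    induction b using AdjoinRoot.induction_on with
    | ih p =>
      -- `p = Z · divX p + C (p₀)`, so `mk p = z · mk (divX p) + of p₀`
      have hp : AdjoinRoot.mk g p =
          AdjoinRoot.root g * AdjoinRoot.mk g p.divX + AdjoinRoot.of g (p.coeff 0) := by
        conv_lhs => rw [← Polynomial.X_mul_divX_add p]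
        rw [map_add, map_mul, AdjoinRoot.mk_X, AdjoinRoot.mk_C]
      rw [RingHom.mem_ker, hp, map_add, map_mul, AdjoinRoot.residueZero_root, zero_mul, zero_add,
        AdjoinRoot.residueZero_of, residue_eq_zero_iff] at hb
      rw [hp]
      exact Ideal.add_mem _ (Ideal.mem_sup_right (Ideal.mul_mem_right _ _ (Ideal.subset_span rfl)))
        (Ideal.mem_sup_left (Ideal.mem_map_of_mem _ hb))
  · refine sup_le ?_ ?_
    · rw [Ideal.map_le_iff_le_comap]
      intro a ha
      rw [Ideal.mem_comap, RingHom.mem_ker, AdjoinRoot.residueZero_of, residue_eq_zero_iff]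
      exact ha
    · rw [Ideal.span_le, Set.singleton_subset_iff, SetLike.mem_coe, RingHom.mem_ker]
      exact AdjoinRoot.residueZero_root hd hy

include hd in
/-- `𝔪B + (z)` is a maximal ideal. [folklore] -/
theorem AdjoinRoot.isMaximal_map_sup_span_root (hy : y ∈ maximalIdeal A) :
    ((maximalIdeal A).map (AdjoinRoot.of g) ⊔ Ideal.span {AdjoinRoot.root g}).IsMaximal := by
  rw [← AdjoinRoot.ker_residueZero hd hy]
  exact RingHom.ker_isMaximal_of_surjective _ (AdjoinRoot.residueZero_surjective hd hy)

include hd in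
/-- **`B = A[Z]/(Z^d − y)` is local** with maximal ideal `𝔪B + (z)`: every maximal ideal of the
integral extension `B` lies over `𝔪` and contains `z` (as `z^d = y ∈ 𝔪B`). [folklore] -/
theorem AdjoinRoot.isLocalRing_and_maximalIdeal_eq (hy : y ∈ maximalIdeal A) :
    ∃ _ : IsLocalRing (AdjoinRoot g),
      maximalIdeal (AdjoinRoot g) =
        (maximalIdeal A).map (AdjoinRoot.of g) ⊔ Ideal.span {AdjoinRoot.root g} := by
  have hmon := monic_X_pow_sub_C_of_pos y hd
  haveI : Module.Finite A (AdjoinRoot g) := hmon.finite_adjoinRoot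
  haveI : Algebra.IsIntegral A (AdjoinRoot g) := inferInstance
  have hmax := AdjoinRoot.isMaximal_map_sup_span_root hd hy
  have huniq : ∀ n : Ideal (AdjoinRoot g), n.IsMaximal →
      n = (maximalIdeal A).map (AdjoinRoot.of g) ⊔ Ideal.span {AdjoinRoot.root g} := by
    intro n hn
    refine (hmax.eq_of_le hn.ne_top ?_).symm
    refine sup_le ?_ ?_
    · have hc : n.comap (algebraMap A (AdjoinRoot g)) = maximalIdeal A := by
        haveI : (n.comap (algebraMap A (AdjoinRoot g))).IsMaximal :=
          Ideal.isMaximal_comap_of_isIntegral_of_isMaximal n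
        exact IsLocalRing.eq_maximalIdeal inferInstance
      rw [Ideal.map_le_iff_le_comap]
      exact hc.ge
    · rw [Ideal.span_le, Set.singleton_subset_iff, SetLike.mem_coe]
      apply hn.isPrime.mem_of_pow_mem d
      have hz : AdjoinRoot.root g ^ d = AdjoinRoot.of g y := by
        have := AdjoinRoot.eval₂_root g
        rwa [eval₂_sub, eval₂_X_pow, eval₂_C, sub_eq_zero] at this
      rw [hz]
      have hc : n.comap (algebraMap A (AdjoinRoot g)) = maximalIdeal A := by
        haveI : (n.comap (algebraMap A (AdjoinRoot g))).IsMaximal :=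
          Ideal.isMaximal_comap_of_isIntegral_of_isMaximal n
        exact IsLocalRing.eq_maximalIdeal inferInstance
      have : y ∈ n.comap (algebraMap A (AdjoinRoot g)) := hc ▸ hy
      exact this
  haveI : IsLocalRing (AdjoinRoot g) := IsLocalRing.of_unique_max_ideal ⟨_, hmax, huniq⟩
  exact ⟨inferInstance, (huniq _ (maximalIdeal.isMaximal _))⟩

end

/-- **Adjoining a `d`-th root of a regular parameter**: for a regular local ring `A` of
dimension `m + 1` with `𝔪 = (x₁, …, x_m, y)` and `d ≥ 1`, `B = A[Z]/(Z^d − y)` is a regular local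
ring of dimension `m + 1` with maximal ideal `(x₁, …, x_m, z)`, and `A → B` is an injective
local homomorphism making `B` a finite free `A`-module. [cite: Matsumura1987, Thm. 14.2]
[cite: Hironaka1967, §1] -/
theorem AdjoinRoot.isRegularLocalRing_X_pow_sub_C [IsRegularLocalRing A] {m : ℕ} (x : Fin m → A)
    (y : A) (hgen : Ideal.span (insert y (Set.range x)) = maximalIdeal A)
    (hdim : ringKrullDim A = m + 1) {d : ℕ} (hd : 0 < d) :
    ∃ _ : IsLocalRing (AdjoinRoot (X ^ d - C y : A[X])),
      IsRegularLocalRing (AdjoinRoot (X ^ d - C y : A[X])) ∧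
      ringKrullDim (AdjoinRoot (X ^ d - C y : A[X])) = m + 1 ∧
      maximalIdeal (AdjoinRoot (X ^ d - C y : A[X])) =
        Ideal.span (insert (AdjoinRoot.root (X ^ d - C y : A[X]))
          (Set.range (AdjoinRoot.of (X ^ d - C y : A[X]) ∘ x))) ∧
      IsLocalHom (algebraMap A (AdjoinRoot (X ^ d - C y : A[X]))) ∧
      Function.Injective (algebraMap A (AdjoinRoot (X ^ d - C y : A[X]))) := by
  set g : A[X] := X ^ d - C y with hg
  have hmon : g.Monic := monic_X_pow_sub_C_of_pos y hd
  haveI : Module.Finite A (AdjoinRoot g) := hmon.finite_adjoinRoot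
  haveI : Module.Free A (AdjoinRoot g) := hmon.free_adjoinRoot
  haveI : Algebra.IsIntegral A (AdjoinRoot g) := inferInstance
  have hy : y ∈ maximalIdeal A := hgen ▸ Ideal.subset_span (Set.mem_insert _ _)
  obtain ⟨hloc, hmaxeq⟩ := AdjoinRoot.isLocalRing_and_maximalIdeal_eq hd hy
  haveI := hloc
  -- injectivity and dimension
  haveI : IsDomain A := isDomain_of_isRegularLocalRing A
  have hinj : Function.Injective (algebraMap A (AdjoinRoot g)) :=
    AdjoinRoot.of.injective_of_degree_ne_zero (by
      rw [hg, degree_X_pow_sub_C hd y]; exact_mod_cast hd.ne')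
  have hdimB : ringKrullDim (AdjoinRoot g) = m + 1 := by
    rw [← Literature.RingTheory.KrullDimension.ringKrullDim_eq_of_isIntegral hinj, hdim]
  -- the maximal ideal
  have hz : AdjoinRoot.root g ^ d = AdjoinRoot.of g y := by
    have := AdjoinRoot.eval₂_root g
    rwa [hg, eval₂_sub, eval₂_X_pow, eval₂_C, sub_eq_zero] at this
  have hmax' : maximalIdeal (AdjoinRoot g) =
      Ideal.span (insert (AdjoinRoot.root g) (Set.range (AdjoinRoot.of g ∘ x))) := by
    rw [hmaxeq, ← hgen, Ideal.map_span]
    apply le_antisymm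
    · refine sup_le (Ideal.span_le.mpr ?_) (Ideal.span_le.mpr ?_)
      · rintro _ ⟨a, ha, rfl⟩
        rcases Set.mem_insert_iff.mp ha with rfl | ⟨i, rfl⟩
        · change AdjoinRoot.of g a ∈ _
          rw [← hz]
          exact Ideal.pow_mem_of_mem _ (Ideal.subset_span (Set.mem_insert _ _)) d hd
        · exact Ideal.subset_span (Set.mem_insert_of_mem _ ⟨i, rfl⟩)
      · rintro _ rfl
        exact Ideal.subset_span (Set.mem_insert _ _)
    · refine Ideal.span_le.mpr ?_
      rintro _ hb
      rcases Set.mem_insert_iff.mp hb with rfl | ⟨i, rfl⟩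
      · exact Ideal.mem_sup_right (Ideal.subset_span rfl)
      · exact Ideal.mem_sup_left (Ideal.subset_span ⟨x i, Set.mem_insert_of_mem _ ⟨i, rfl⟩, rfl⟩)
  -- regularity: `𝔪_B` has `≤ m + 1 = dim B` generators
  have hreg : IsRegularLocalRing (AdjoinRoot g) := by
    classical
    haveI : IsNoetherianRing (AdjoinRoot g) := inferInstance
    refine IsRegularLocalRing.of_spanFinrank_maximalIdeal_le (R := AdjoinRoot g) ?_
    rw [hdimB, hmax']
    have hS : (insert (AdjoinRoot.root g) (Set.range (AdjoinRoot.of g ∘ x))) =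
        ↑(insert (AdjoinRoot.root g) (Finset.univ.image (AdjoinRoot.of g ∘ x))) := by
      ext b; simp
    have hfin : (insert (AdjoinRoot.root g) (Set.range (AdjoinRoot.of g ∘ x))).Finite := by
      rw [hS]; exact Finset.finite_toSet _
    have h1 := Submodule.spanFinrank_span_le_ncard_of_finite (R := AdjoinRoot g) hfin
    have h2 : (insert (AdjoinRoot.root g) (Set.range (AdjoinRoot.of g ∘ x))).ncard ≤ m + 1 := by
      rw [hS, Set.ncard_coe_finset]
      calc (insert (AdjoinRoot.root g) (Finset.univ.image (AdjoinRoot.of g ∘ x))).card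
          ≤ (Finset.univ.image (AdjoinRoot.of g ∘ x)).card + 1 := Finset.card_insert_le _ _
        _ ≤ m + 1 := by
          have := Finset.card_image_le (s := Finset.univ) (f := AdjoinRoot.of g ∘ x)
          rw [Finset.card_univ, Fintype.card_fin] at this
          omega
    exact_mod_cast h1.trans h2
  -- the structure map is local
  have hlocal : IsLocalHom (algebraMap A (AdjoinRoot g)) := by
    refine ⟨fun a ha => ?_⟩
    by_contra hna
    have h1 : algebraMap A (AdjoinRoot g) a ∈ maximalIdeal (AdjoinRoot g) := by
      rw [hmaxeq]
      exact Ideal.mem_sup_left (Ideal.mem_map_of_mem _ ((IsLocalRing.mem_maximalIdeal _).mpr hna))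
    exact (IsLocalRing.mem_maximalIdeal _).mp h1 ha
  exact ⟨hloc, hreg, hdimB, hmax', hlocal, hinj⟩

end Literature.AlgebraicGeometry.Resolution

end
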